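import Literature.NumberTheory.LFunctions.RodgersTaoRiemannVonMangoldtProofs
import HarnessLib

/-!
# Rodgers–Tao 2020, Corollary 3.3 eq. (52) as an RH-FREE schema: gaps from counts — proofs

RH-FREE CONTENT (no definitions, no named facts). Trunk T-ANT (`Literature/NumberTheory/LFunctions`);
the third Corollary-3.3 schema of cell rh-crit/rt (row «(52) schema ⟸ (49)+(50)», rt-lead rulings
(34)/(40), rt/STATUS 2026-08-26; signature sketch rt-t7 g2 10:01:06Z), companion of the two landed
schemas `Literature.NumberTheory.LFunctions.RodgersTao2020.cor33_location_of_count_estimate` ((50) ⟸ (48),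
p429135) and `RodgersTao2020.cor33_order_of_location` ((51) ⟸ (50), p430080) in
`RodgersTaoRiemannVonMangoldtProofs.lean`, and of the AS-PRINTED (VACUOUS-AS-PRINTED, `Λ < t ≤ 0`)
record `Literature.NumberTheory.LFunctions.RodgersTao2020.cor33_gaps` (`RodgersTaoRiemannVonMangoldt.lean`).

> B. Rodgers, T. Tao, *The de Bruijn–Newman constant is non-negative*, Forum Math. Pi 8 (2020)
> e6 = arXiv:1801.05914v5, **Corollary 3.3** (= FMP Corollary 10, p. 23), eq. (52): «We also have
> `x_k(t) − x_j(t) = 4π(k − j)/log₊ ξ_j + o_{j→∞}(log₊ ξ_j)` whenever `1 ≤ j < k ≤ j + log²₊ ξ_j`.»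
> Proof in print: «Repeating the previous analysis, we conclude», i.e. the short-interval count (49)
> of Theorem 3.2 (= FMP Theorem 9) between consecutive zeros, as on pp. 21–22 for (44)–(47).

## The schema (one fixed time `t` above a time with only real zeros — no `t ≤ 0`)

`RodgersTao2020.cor33_gaps_of_count_estimates`: at a time `t` with `∃ t₁ < t, H_{t₁}` has only real
zeros (so that `x_j(t)` enumerates the positive real zeros of `H_t` and `N_t` counts them,
`RodgersTaoZeroSet.lean`), the (50)-shape location law `|x_j(t) − ξ_j| ≤ B log₊ ξ_j` (`j ≥ 1`) and
the (49)-shape short-interval count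
`∀ C > 0, ∀ ε > 0, ∃ T₀, ∀ α ∈ [0, C], ∀ T ≥ T₀, |N_t([T, T + α log₊ T]) − α log²₊ T/(4π)| ≤ ε log²₊ T`
imply the (52)-shape gap law `∀ ε > 0, ∃ j₀, ∀ j ≥ j₀, ∀ k, j < k ≤ j + log²₊ ξ_j ⇒
|x_k(t) − x_j(t) − 4π(k−j)/log₊ ξ_j| ≤ ε log₊ ξ_j`.

Route (the (44)–(47) argument of pp. 21–22 at time `t`; rt-t7's sketch):
`N_t([x_j, x_k]) = k − j + 1` exactly (`deBruijnZeroCount_Icc_deBruijnZero_deBruijnZero`); with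
`α* = (x_k − x_j)/log₊ x_j`, the count (49) at `T = x_j`, `α = α*` gives
`|k − j + 1 − α* log²₊ x_j/4π| ≤ ε′ log²₊ x_j` once `α* ≤ C` is known — and `α* > C = 16π` is
impossible, since (49) at `α = C` would put `≥ (4 − ε′) log²₊ x_j` zeros in
`[x_j, x_j + C log₊ x_j] ⊆ [x_j, x_k]`, which holds `k − j + 1 ≤ log²₊ ξ_j + 1` of them; finally
`log₊ x_j = (1 + o(1)) log₊ ξ_j` by the location law (`|log₊ x_j − log₊ ξ_j| ≤ 2B log₊ ξ_j/ξ_j → 0`,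
`ξ_j ≥ √j → ∞`).

bears_on: N-C/N-P (COLUMN 3 DBN). WHAT THIS IS NOT: a counting-to-spacing deduction about the real
zeros of `H_t` at a time `t > Λ ≥ 0` (for `t > 0` these are not zeros of `ζ`); the printed `Λ < t ≤ 0`
instance is vacuous in the tree (`Λ ≥ 0`); nothing here bears on the truth of RH.
-/

noncomputable section

open Real Set Filter Topology

namespace Literature.NumberTheory.LFunctions.RodgersTao2020

/-! ## Counting between two enumerated zeros -/

/-- **`N_t([x_j(t), x_k(t)]) = k − j + 1`** for `1 ≤ j` (both sides vanish when `k < j`) at a time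
`t > Λ`: the real zeros of `H_t` in `[x_j(t), x_k(t)]` are exactly `x_j(t), …, x_k(t)` (the `x_i(t)`
enumerate the positive zeros increasingly, `RodgersTaoZeroSet.lean`).
[cite: RodgersTaoFMP2020, §3 p.20 (N_t and x_j)] -/
theorem deBruijnZeroCount_Icc_deBruijnZero_deBruijnZero {t : ℝ}
    (hΛ : ∃ t₁ : ℝ, t₁ < t ∧ HasOnlyRealZeros (deBruijnH t₁)) {j k : ℕ} (hj : 1 ≤ j) :
    deBruijnZeroCount t (Icc (deBruijnZero t j) (deBruijnZero t k)) = k + 1 - j := by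
  have hmono := strictMono_deBruijnZero hΛ
  have hset : {x : ℝ | x ∈ Icc (deBruijnZero t j) (deBruijnZero t k) ∧ deBruijnH t x = 0} =
      (deBruijnZero t) '' (Finset.Icc j k : Set ℕ) := by
    ext x
    constructor
    · rintro ⟨⟨hxj, hxk⟩, hx⟩
      have hx0 : 0 < x := lt_of_lt_of_le (deBruijnZero_pos hΛ hj) hxj
      obtain ⟨i, -, rfl⟩ := exists_deBruijnZero_eq hΛ hx0 hx
      refine ⟨i, ?_, rfl⟩
      rw [Finset.coe_Icc]
      exact ⟨hmono.le_iff_le.1 hxj, hmono.le_iff_le.1 hxk⟩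
    · rintro ⟨i, hi, rfl⟩
      rw [Finset.coe_Icc] at hi
      refine ⟨⟨hmono.monotone hi.1, hmono.monotone hi.2⟩, ?_⟩
      exact deBruijnH_deBruijnZero hΛ (hj.trans hi.1)
  rw [deBruijnZeroCount_eq, hset, Set.ncard_image_of_injective _ hmono.injective,
    Set.ncard_coe_finset, Nat.card_Icc]

/-- `N_t([a, b]) ≤ N_t([a, b'])` for `b ≤ b'` (the zero set in a compact interval is finite).
[cite: RodgersTaoFMP2020, §3 p.20 (N_t)] -/
theorem deBruijnZeroCount_Icc_mono_right (t a : ℝ) {b b' : ℝ} (h : b ≤ b') :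
    deBruijnZeroCount t (Icc a b) ≤ deBruijnZeroCount t (Icc a b') := by
  rw [deBruijnZeroCount_eq, deBruijnZeroCount_eq]
  exact Set.ncard_le_ncard (fun x hx ↦ ⟨⟨hx.1.1, hx.1.2.trans h⟩, hx.2⟩)
    (finite_real_zeros_deBruijnH_Icc t a b')

/-! ## Elementary comparisons -/

/-- `|log₊ x − log₊ ξ| ≤ 2|x − ξ|/ξ` for `x ≥ 0`, `ξ > 0`, `x ≥ ξ/2` (mean-value bound
`|log a − log b| ≤ |a − b|/min(a, b)` with `a = 2 + x`, `b = 2 + ξ`, `min ≥ ξ/2`).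
[cite: RodgersTaoFMP2020, §1.2 p.7 (log₊)] -/
theorem abs_logPlus_sub_logPlus_le {x ξ : ℝ} (hx : 0 ≤ x) (hξ : 0 < ξ) (hmin : ξ / 2 ≤ x) :
    |logPlus x - logPlus ξ| ≤ 2 * |x - ξ| / ξ := by
  rw [logPlus_of_nonneg hx, logPlus_of_nonneg hξ.le]
  have ha : 0 < 2 + x := by linarith
  have hb : 0 < 2 + ξ := by linarith
  -- `|log a − log b| ≤ |a − b| / (ξ/2)`
  rw [abs_le]
  constructor
  · -- `log b − log a ≤ (b − a)/a ≤ 2|x−ξ|/ξ`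
    have h1 : Real.log (2 + ξ) - Real.log (2 + x) ≤ (2 + ξ) / (2 + x) - 1 := by
      rw [← Real.log_div hb.ne' ha.ne']
      exact Real.log_le_sub_one_of_pos (div_pos hb ha)
    have h2 : (2 + ξ) / (2 + x) - 1 = (ξ - x) / (2 + x) := by field_simp; ring
    have h3 : (ξ - x) / (2 + x) ≤ 2 * |x - ξ| / ξ := by
      rw [div_le_div_iff₀ ha hξ]
      have h4 : ξ - x ≤ |x - ξ| := by rw [abs_sub_comm]; exact le_abs_self _
      nlinarith [abs_nonneg (x - ξ)]
    linarith
  · -- `log a − log b ≤ (a − b)/b ≤ 2|x−ξ|/ξ`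
    have h1 : Real.log (2 + x) - Real.log (2 + ξ) ≤ (2 + x) / (2 + ξ) - 1 := by
      rw [← Real.log_div ha.ne' hb.ne']
      exact Real.log_le_sub_one_of_pos (div_pos ha hb)
    have h2 : (2 + x) / (2 + ξ) - 1 = (x - ξ) / (2 + ξ) := by field_simp; ring
    have h3 : (x - ξ) / (2 + ξ) ≤ 2 * |x - ξ| / ξ := by
      rw [div_le_div_iff₀ hb hξ]
      have h4 : x - ξ ≤ |x - ξ| := le_abs_self _
      nlinarith [abs_nonneg (x - ξ)]
    linarith

/-- **`ξ_j → ∞`** along the naturals (`ξ_j ≥ √j`, Lemma 3.1 (i)). [cite: RodgersTaoFMP2020, Lemma 3.1 (i) = Lemma 8 p.21] -/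
theorem tendsto_classicalLocation_natCast :
    Tendsto (fun j : ℕ ↦ classicalLocation (j : ℝ)) atTop atTop := by
  refine tendsto_atTop_atTop.2 fun M ↦ ⟨Nat.ceil (M ^ 2) + 1, fun j hj ↦ ?_⟩
  have hj1 : (1 : ℝ) ≤ j := by
    have : 1 ≤ j := le_trans (Nat.le_add_left 1 _) hj
    exact_mod_cast this
  have hjM : M ^ 2 ≤ (j : ℝ) := by
    have h1 : (Nat.ceil (M ^ 2) : ℝ) ≤ j := by exact_mod_cast (Nat.le_succ _).trans hj
    exact (Nat.le_ceil _).trans h1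
  have hsq := le_classicalLocation_sq hj1
  have hξ0 : 0 ≤ classicalLocation (j : ℝ) := (classicalLocation_pos (by linarith)).le
  by_contra hlt
  push Not at hlt
  rcases le_or_gt M 0 with hM | hM
  · exact absurd (hM.trans hξ0) (not_le.2 hlt)
  · have : classicalLocation (j : ℝ) ^ 2 < M ^ 2 := pow_lt_pow_left₀ hlt hξ0 two_ne_zero
    linarith

/-- `log(2 + ξ) ≤ c ξ` for all large `ξ`, for every `c > 0` (`log = o(id)`).
[cite: RodgersTaoFMP2020, §1.2 p.7 (log₊)] -/
theorem eventually_log_two_add_le_mul {c : ℝ} (hc : 0 < c) :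
    ∀ᶠ ξ : ℝ in atTop, Real.log (2 + ξ) ≤ c * ξ := by
  have h := (Real.isLittleO_log_id_atTop.bound (half_pos hc))
  filter_upwards [h, eventually_ge_atTop (1 : ℝ), eventually_ge_atTop (2 * Real.log 3 / c)]
    with ξ hξ h1 h3
  rw [id, Real.norm_eq_abs, Real.norm_eq_abs, abs_of_nonneg (Real.log_nonneg h1),
    abs_of_nonneg (by linarith)] at hξ
  have h4 : Real.log (2 + ξ) ≤ Real.log 3 + Real.log ξ := by
    rw [← Real.log_mul (by norm_num) (by linarith)]
    exact Real.log_le_log (by linarith) (by linarith)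
  have h5 : Real.log 3 ≤ c / 2 * ξ := by
    rw [div_le_iff₀ hc] at h3
    linarith
  linarith

/-! ## The (52) schema -/

set_option maxHeartbeats 400000 in
/-- **Corollary 3.3, eq. (52), as an RH-FREE schema** (the printed deduction «repeating the previous
analysis», FMP p. 23, performed at ONE time `t` lying above a time with only real zeros): the
(50)-shape location law `x_j(t) = ξ_j + O(log₊ ξ_j)` and the (49)-shape short-interval counts
`N_t([T, T + α log₊ T]) = α log²₊T/4π + o(log²₊ T)` (uniformly in `0 ≤ α ≤ C`, every `C`) imply the
gap law (52) `x_k(t) − x_j(t) = 4π(k − j)/log₊ ξ_j + o_{j→∞}(log₊ ξ_j)` for `j < k ≤ j + log²₊ ξ_j`.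
No hypothesis `t ≤ 0` and no use of the standing hypothesis `Λ < 0`: this is the content of (52)
separated from Theorem 3.2. [cite: RodgersTaoFMP2020, Corollary 3.3 = Corollary 10 eq. (52) p.23 (deduction from (49), (50))] -/
theorem cor33_gaps_of_count_estimates {t : ℝ}
    (hΛ : ∃ t₁ : ℝ, t₁ < t ∧ HasOnlyRealZeros (deBruijnH t₁)) {B : ℝ}
    (h50 : ∀ j : ℕ, 1 ≤ j →
      |deBruijnZero t j - classicalLocation (j : ℝ)| ≤ B * logPlus (classicalLocation (j : ℝ)))
    (h49 : ∀ C : ℝ, 0 < C → ∀ ε : ℝ, 0 < ε → ∃ T₀ : ℝ, ∀ α : ℝ, 0 ≤ α → α ≤ C → ∀ T : ℝ,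
      T₀ ≤ T → |(deBruijnZeroCount t (Icc T (T + α * logPlus T)) : ℝ) -
        α * logPlus T ^ 2 / (4 * π)| ≤ ε * logPlus T ^ 2) :
    ∀ ε : ℝ, 0 < ε → ∃ j₀ : ℕ, ∀ j k : ℕ, j₀ ≤ j → j < k →
      (k : ℝ) ≤ j + logPlus (classicalLocation (j : ℝ)) ^ 2 →
        |deBruijnZero t k - deBruijnZero t j -
            4 * π * ((k : ℝ) - j) / logPlus (classicalLocation (j : ℝ))| ≤
          ε * logPlus (classicalLocation (j : ℝ)) := by
  intro ε hε
  have hπ := Real.pi_pos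
  have hπ3 := Real.pi_gt_three
  -- `B ≥ 0`
  have hB0 : 0 ≤ B := by
    have h := h50 1 le_rfl
    by_contra hB
    have : B * logPlus (classicalLocation ((1 : ℕ) : ℝ)) < 0 :=
      mul_neg_of_neg_of_pos (lt_of_not_ge hB) (logPlus_pos _)
    linarith [abs_nonneg (deBruijnZero t 1 - classicalLocation ((1 : ℕ) : ℝ))]
  -- parameters
  set C : ℝ := 16 * π with hC
  have hC0 : 0 < C := by positivity
  set ε' : ℝ := min (1 / 2) (ε / (32 * π)) with hε'
  have hε'0 : 0 < ε' := lt_min (by norm_num) (by positivity)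
  have hε'1 : ε' ≤ 1 / 2 := min_le_left _ _
  have hε'2 : ε' ≤ ε / (32 * π) := min_le_right _ _
  set δ : ℝ := min (1 / 20) (ε / (32 * π)) with hδ
  have hδ0 : 0 < δ := lt_min (by norm_num) (by positivity)
  have hδ1 : δ ≤ 1 / 20 := min_le_left _ _
  have hδ2 : δ ≤ ε / (32 * π) := min_le_right _ _
  obtain ⟨T₀, hT₀⟩ := h49 C hC0 ε' hε'0
  -- largeness conditions on `ξ = ξ_j`, pulled back along `ξ_j → ∞`
  have hev : ∀ᶠ ξ : ℝ in atTop, 4 * B * Real.log (2 + ξ) ≤ ξ ∧ 2 * T₀ ≤ ξ ∧ 8 * π ≤ ξ ∧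
      2 * B ≤ δ * ξ ∧ 32 * π / ε ≤ Real.log (2 + ξ) ^ 2 := by
    have hA : ∀ᶠ ξ : ℝ in atTop, 4 * B * Real.log (2 + ξ) ≤ ξ := by
      rcases eq_or_lt_of_le hB0 with hB | hB
      · filter_upwards [eventually_ge_atTop (0 : ℝ)] with ξ hξ
        rw [← hB]; simpa using hξ
      · filter_upwards [eventually_log_two_add_le_mul (show 0 < 1 / (4 * B) by positivity)] with ξ hξ
        have := mul_le_mul_of_nonneg_left hξ (show 0 ≤ 4 * B by positivity)
        calc 4 * B * Real.log (2 + ξ) ≤ 4 * B * (1 / (4 * B) * ξ) := this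
          _ = ξ := by field_simp
    have hD : ∀ᶠ ξ : ℝ in atTop, 32 * π / ε ≤ Real.log (2 + ξ) ^ 2 := by
      have hlog : Tendsto (fun ξ : ℝ ↦ Real.log (2 + ξ)) atTop atTop :=
        Real.tendsto_log_atTop.comp (tendsto_atTop_add_const_left _ _ tendsto_id)
      have hsq : Tendsto (fun ξ : ℝ ↦ Real.log (2 + ξ) ^ 2) atTop atTop :=
        (tendsto_pow_atTop two_ne_zero).comp hlog
      exact hsq.eventually_ge_atTop _
    filter_upwards [hA, eventually_ge_atTop (2 * T₀), eventually_ge_atTop (8 * π),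
      eventually_ge_atTop (2 * B / δ), hD] with ξ h1 h2 h3 h4 h5
    refine ⟨h1, h2, h3, ?_, h5⟩
    rw [div_le_iff₀ hδ0] at h4
    exact h4.trans_eq (mul_comm _ _)
  obtain ⟨j₁, hj₁⟩ := eventually_atTop.1 (tendsto_classicalLocation_natCast.eventually hev)
  refine ⟨max j₁ 1, fun j k hj hjk hk ↦ ?_⟩
  have hj1 : 1 ≤ j := le_trans (le_max_right _ _) hj
  have hk1 : 1 ≤ k := hj1.trans hjk.le
  obtain ⟨hAξ, hTξ, h8π, hBδ, hΛε⟩ := hj₁ j (le_trans (le_max_left _ _) hj)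
  -- notation
  set ξ : ℝ := classicalLocation (j : ℝ) with hξdef
  set x : ℝ := deBruijnZero t j with hxdef
  set y : ℝ := deBruijnZero t k with hydef
  set Λ : ℝ := logPlus ξ with hΛdef
  set L : ℝ := logPlus x with hLdef
  have hξ0 : 0 < ξ := by linarith
  have hΛ0 : 0 < Λ := logPlus_pos ξ
  have hL0 : 0 < L := logPlus_pos x
  have hΛeq : Λ = Real.log (2 + ξ) := logPlus_of_nonneg hξ0.le
  have hΛ2 : 0.69 ≤ Λ := by
    have h1 := log_two_le_logPlus ξ
    have h2 := Real.log_two_gt_d9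
    rw [← hΛdef] at h1
    linarith
  have hΛsq : 0.4761 ≤ Λ ^ 2 := by
    have := pow_le_pow_left₀ (by norm_num) hΛ2 2
    norm_num at this
    linarith
  have hδΛ : δ * Λ ≤ 1 / 20 * Λ := mul_le_mul_of_nonneg_right hδ1 hΛ0.le
  -- (50) at `j`: `x` is within `BΛ ≤ ξ/4` of `ξ`
  have h50j : |x - ξ| ≤ B * Λ := h50 j hj1
  have hBΛ : B * Λ ≤ ξ / 4 := by rw [hΛeq]; linarith
  have hxlo : ξ / 2 ≤ x := by linarith [(abs_le.1 (h50j.trans hBΛ)).1]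
  have hxhi : x ≤ 2 * ξ := by linarith [(abs_le.1 (h50j.trans hBΛ)).2]
  have hx0 : 0 < x := by linarith
  have hxT : T₀ ≤ x := by linarith
  -- `|L − Λ| ≤ δ Λ`
  have hLΛ : |L - Λ| ≤ δ * Λ := by
    have h1 := abs_logPlus_sub_logPlus_le hx0.le hξ0 hxlo
    rw [← hLdef, ← hΛdef] at h1
    calc |L - Λ| ≤ 2 * |x - ξ| / ξ := h1
      _ ≤ 2 * (B * Λ) / ξ := by gcongr
      _ = (2 * B) / ξ * Λ := by ring
      _ ≤ (δ * ξ) / ξ * Λ := by gcongr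
      _ = δ * Λ := by field_simp
  have hLge : (19 / 20) * Λ ≤ L := by
    have := (abs_le.1 hLΛ).1
    linarith
  have hLlo : Λ / 2 ≤ L := by linarith
  have hLhi : L ≤ 2 * Λ := by
    have := (abs_le.1 hLΛ).2
    linarith
  have hL2lo : (19 / 20) ^ 2 * Λ ^ 2 ≤ L ^ 2 := by
    calc (19 / 20) ^ 2 * Λ ^ 2 = ((19 / 20) * Λ) ^ 2 := by ring
      _ ≤ L ^ 2 := pow_le_pow_left₀ (by positivity) hLge 2
  -- the gap in units of `L`
  have hxy : x < y := strictMono_deBruijnZero hΛ hjk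
  set n : ℝ := (k : ℝ) - j with hndef
  have hn1 : 1 ≤ n := by
    rw [hndef]
    have : (j : ℝ) + 1 ≤ k := by exact_mod_cast hjk
    linarith
  have hnΛ : n ≤ Λ ^ 2 := by rw [hndef]; linarith
  -- the exact count between `x_j` and `x_k`
  have hcount : (deBruijnZeroCount t (Icc x y) : ℝ) = n + 1 := by
    rw [hxdef, hydef, deBruijnZeroCount_Icc_deBruijnZero_deBruijnZero hΛ hj1, hndef]
    have : j ≤ k + 1 := by omega
    push_cast [Nat.cast_sub this]
    ring
  -- Step A: `y ≤ x + C L` (else (49) at `α = C` puts too many zeros in `[x, x + CL] ⊆ [x, y]`)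
  have hyC : y ≤ x + C * L := by
    by_contra hgt
    push Not at hgt
    have hmono := deBruijnZeroCount_Icc_mono_right t x hgt.le
    have hle : (deBruijnZeroCount t (Icc x (x + C * L)) : ℝ) ≤ n + 1 := by
      rw [← hcount]; exact_mod_cast hmono
    have h49C := hT₀ C hC0.le le_rfl x hxT
    rw [← hLdef] at h49C
    have hge : C * L ^ 2 / (4 * π) - ε' * L ^ 2 ≤ (deBruijnZeroCount t (Icc x (x + C * L)) : ℝ) := by
      have := (abs_le.1 h49C).1; linarith
    have hCL : C * L ^ 2 / (4 * π) = 4 * L ^ 2 := by rw [hC]; field_simp; ring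
    rw [hCL] at hge
    -- `(4 − ε') L² ≥ 3.5 L² ≥ 3.5·(19/20)² Λ² > Λ² + 1 ≥ n + 1`
    have h1 : (7 / 2) * L ^ 2 ≤ 4 * L ^ 2 - ε' * L ^ 2 := by
      have := mul_le_mul_of_nonneg_right hε'1 (sq_nonneg L)
      linarith
    have h2 : Λ ^ 2 + 1 < (7 / 2) * ((19 / 20) ^ 2 * Λ ^ 2) := by
      norm_num
      linarith
    have h3 : (7 / 2) * ((19 / 20) ^ 2 * Λ ^ 2) ≤ (7 / 2) * L ^ 2 := by linarith
    linarith
  -- Step B: (49) at `α* = (y − x)/L ∈ [0, C]`, `T = x`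
  set α : ℝ := (y - x) / L with hαdef
  have hα0 : 0 ≤ α := div_nonneg (by linarith) hL0.le
  have hαC : α ≤ C := by rw [hαdef, div_le_iff₀ hL0]; linarith
  have hαL : x + α * L = y := by rw [hαdef]; field_simp; ring
  have h49α := hT₀ α hα0 hαC x hxT
  rw [← hLdef, hαL, hcount] at h49α
  -- `|y − x − 4π(n+1)/L| ≤ 4π ε' L`
  have hB1 : |(y - x) - 4 * π * (n + 1) / L| ≤ 4 * π * ε' * L := by
    have e : (y - x) - 4 * π * (n + 1) / L = -(4 * π / L) * ((n + 1) - α * L ^ 2 / (4 * π)) := by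
      rw [hαdef]; field_simp; ring
    rw [e, abs_mul, abs_neg, abs_of_pos (by positivity : 0 < 4 * π / L)]
    calc 4 * π / L * |n + 1 - α * L ^ 2 / (4 * π)| ≤ 4 * π / L * (ε' * L ^ 2) :=
          mul_le_mul_of_nonneg_left h49α (by positivity)
      _ = 4 * π * ε' * L := by field_simp
  -- Step C: change `(n+1)/L` into `n/Λ`
  have hC1 : |4 * π * (n + 1) / L - 4 * π * n / Λ| ≤ 4 * π / L + 4 * π * n * (δ * Λ) / (L * Λ) := by
    have e : 4 * π * (n + 1) / L - 4 * π * n / Λ = 4 * π / L + 4 * π * n * (Λ - L) / (L * Λ) := by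
      field_simp; ring
    rw [e]
    calc |4 * π / L + 4 * π * n * (Λ - L) / (L * Λ)|
        ≤ |4 * π / L| + |4 * π * n * (Λ - L) / (L * Λ)| := abs_add_le _ _
      _ = 4 * π / L + 4 * π * n * |Λ - L| / (L * Λ) := by
          rw [abs_of_pos (by positivity : 0 < 4 * π / L), abs_div, abs_mul,
            abs_of_pos (by positivity : 0 < 4 * π * n), abs_of_pos (by positivity : 0 < L * Λ)]
      _ ≤ 4 * π / L + 4 * π * n * (δ * Λ) / (L * Λ) := by
          rw [abs_sub_comm] at hLΛ
          gcongr
  -- the three error terms are each `≤ (ε/4, ε/2, ε/4) · Λ`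
  have hT1 : 4 * π * ε' * L ≤ ε / 4 * Λ := by
    calc 4 * π * ε' * L ≤ 4 * π * (ε / (32 * π)) * (2 * Λ) := by gcongr
      _ = ε / 4 * Λ := by field_simp; ring
  have hT2 : 4 * π / L ≤ ε / 4 * Λ := by
    -- `4π/L ≤ 8π/Λ ≤ (ε/4)·Λ`: use `Λ² ≥ 32π/ε` and `L ≥ Λ/2`
    rw [div_le_iff₀ hL0]
    have h1 : 32 * π ≤ ε * Λ ^ 2 := by
      have := (div_le_iff₀ hε).1 hΛε
      rw [← hΛeq] at this
      linarith
    have h2 : ε / 4 * Λ * (Λ / 2) ≤ ε / 4 * Λ * L := mul_le_mul_of_nonneg_left hLlo (by positivity)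
    have h3 : ε / 4 * Λ * (Λ / 2) = ε * Λ ^ 2 / 8 := by ring
    linarith
  have hT3 : 4 * π * n * (δ * Λ) / (L * Λ) ≤ ε / 2 * Λ := by
    rw [div_le_iff₀ (by positivity)]
    have h1 : 4 * π * n * (δ * Λ) ≤ 4 * π * Λ ^ 2 * ((ε / (32 * π)) * Λ) := by
      have : n * δ ≤ Λ ^ 2 * (ε / (32 * π)) :=
        mul_le_mul hnΛ hδ2 hδ0.le (by positivity)
      have h0 : 0 ≤ 4 * π * Λ := by positivity
      calc 4 * π * n * (δ * Λ) = 4 * π * Λ * (n * δ) := by ring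
        _ ≤ 4 * π * Λ * (Λ ^ 2 * (ε / (32 * π))) := mul_le_mul_of_nonneg_left this h0
        _ = 4 * π * Λ ^ 2 * ((ε / (32 * π)) * Λ) := by ring
    have h2 : 4 * π * Λ ^ 2 * ((ε / (32 * π)) * Λ) = ε * Λ ^ 2 * Λ / 8 := by field_simp; ring
    have h3 : ε * Λ ^ 2 / 2 * (Λ / 2) ≤ ε * Λ ^ 2 / 2 * L :=
      mul_le_mul_of_nonneg_left hLlo (by positivity)
    have h4 : ε / 2 * Λ * (L * Λ) = ε * Λ ^ 2 / 2 * L := by ring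
    have h5 : 0 ≤ ε * Λ ^ 2 * Λ := by positivity
    rw [h4]
    linarith
  -- assemble
  have hfin : |y - x - 4 * π * n / Λ| ≤ ε * Λ := by
    calc |y - x - 4 * π * n / Λ|
        = |((y - x) - 4 * π * (n + 1) / L) + (4 * π * (n + 1) / L - 4 * π * n / Λ)| := by
          congr 1; ring
      _ ≤ |(y - x) - 4 * π * (n + 1) / L| + |4 * π * (n + 1) / L - 4 * π * n / Λ| := abs_add_le _ _
      _ ≤ 4 * π * ε' * L + (4 * π / L + 4 * π * n * (δ * Λ) / (L * Λ)) := add_le_add hB1 hC1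
      _ ≤ ε / 4 * Λ + (ε / 4 * Λ + ε / 2 * Λ) := add_le_add hT1 (add_le_add hT2 hT3)
      _ = ε * Λ := by ring
  exact hfin

end Literature.NumberTheory.LFunctions.RodgersTao2020

end
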